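import Summits.ValiantsHypothesis.ValiantsHypothesis.Theses.AnyonJets
import Literature.Computability.AlgebraicComplexity.ArithCircuitProofs
import Literature.Computability.AlgebraicComplexity.ConstantFreeCircuits
import Literature.Computability.AlgebraicComplexity.DetInVP
import Literature.Computability.AlgebraicComplexity.FermionicPencil
import Literature.Computability.AlgebraicComplexity.BurgisserBooleanPartsModPCircuits

/-!
# Birth skeleton — crux `ConstantFreeJetGrowth` (item `stmt-ValiantsHypothesis-16738`), line `birth`

Route `route-ValiantsHypothesis-AnyonJets`, crux
`Summit.ValiantsHypothesis.ValiantsHypothesis.Theses.AnyonJets.ConstantFreeJetGrowth`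
(CONSTANT-FREE JET GROWTH, io form: for every `c` some FIXED order `k ≥ 1` of the anyonic jet
`J_(n,k) = Σ_σ sgn σ · C(inv σ, k) · x^σ` has constant-free complexity `τ(J_(n,k)) ≥ n^c` for
infinitely many `n`).

This is the route's own planned layer-2 split of the crux (route header, TWO-LAYER PLAN:
`ConstantFreeJetGrowth ⇐ PerModPowBooleanHard → BooleanShadowToCF`), with the bridge
`BooleanShadowToCF` opened up into its two genuine mathematical pieces — the 2-ADIC SHADOW of the
resummation `per = Σ_k (−2)^k J_k` read at 0/1 points, and Bürgisser's BOOLEAN SIMULATION of integer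
straight-line programs modulo `2^k` — so that the composition proved here is the actual transfer
argument (contrapositive: a `k`-uniform exponent for the constant-free cost of the fixed jets puts
the `k` low bits of the 0/1 permanent into `n^(O(1))`-size `B₂`-circuits, uniformly in `k`):

* `stub_perModPowBooleanHard` (A — THE BOOLEAN FAR SIDE, the hypothesis `H` this line uses; open,
  conjecture-grade; verbatim the route's support item `PerModPowBooleanHard`, stmt-16743): for every
  `c` some fixed `k ≥ 1` has: the `k` low bits of the number of permutations supported on a 0/1
  `n × n` array (= `per mod 2^k`) admit no `B₂`-circuits of size `≤ n^c` for infinitely many `n`.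
  The nonuniform, fixed-exponent shadow of Curticapean–Xia's `⊕W[1]`-hardness of `per mod 2^k`
  [CurticapeanXia2015]; upper bounds `n^(4k−3)` [Valiant1979Permanent, §4], `n^(k+O(1))`
  [BjorklundHusfeldtLyckberg2017]. Why it might fail: an `n^(c₀)`-size circuit family for
  `per mod 2^k` with `c₀` independent of `k` (a nonuniform collapse of the parameterized hardness).
* `stub_twoAdicShadowCongruence` (B — THE 2-ADIC SHADOW AT 0/1 POINTS; provable now, M-sized):
  for every 0/1 matrix `y`, `Σ_(j<k) (−2)^j J_(n,j)(y) ≡ #{σ : y ⊇ σ} (mod 2^k)`, stated as an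
  identity in `ZMod (2^k)` under `MvPolynomial.aeval`. Mechanism: termwise
  `sgn σ · Σ_(j<k) (−2)^j C(inv σ, j) ≡ sgn σ · (1 − 2)^(inv σ) = sgn σ · (−1)^(inv σ) = 1 (mod 2^k)`
  (terms `j ≥ k` vanish mod `2^k`; `sgn σ = (−1)^(inv σ)`), and `x^σ(y) = [∀ i, y (σ i, i)]`
  [Valiant1979Permanent §4; route supports Resummation stmt-16740 / TwoAdicShadow stmt-16742].
* `stub_booleanSimulation` (C — BOOLEAN SIMULATION MOD `2^k` AT 0/1 INPUTS; provable now from the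
  tree, M-sized): one exponent `d` such that for every integer polynomial `f` on the `n × n` matrix
  the `k` bits of `f(y) mod 2^k` (`y` a 0/1 point) have `B₂`-circuits of size
  `((L_ℤ(f) + 2)(k + 2))^d`. Mechanism: `cktSize_testBits_aeval_eval` [Burgisser2000TCS §5 (A3)]
  applied to a size-`L_ℤ(f)` circuit (`exists_computes_size_eq_complexity`), modulus `p = 2^k ≤ 2^k`,
  input residues `[y v] ∈ {0,1}` whose bits cost one constant gate; `gateCost_le` makes `d = 7` work.
* `ConstantFreeJetGrowth_of : Registered.stub_perModPowBooleanHard →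
  Registered.stub_twoAdicShadowCongruence → Registered.stub_booleanSimulation →
  ConstantFreeJetGrowth` — the composition, PROVED here (sorry-free): negate the crux (one exponent
  `c` bounds `τ(J_(n,k))` eventually for every fixed `k ≥ 1`), bound the INTEGER complexity of the
  truncated resummation `F_(n,k) = Σ_(j<k) (−2)^j J_(n,j)` by `k(8(n+1)^7 + n^c + 1) + k`
  (`J_(n,0) = det_n`, Berkowitz `complexity_detPoly_le`; `L_ℤ ≤ τ` for `j ≥ 1`; cost calculus of `L`),
  simulate it Booleanly (C), identify the output bits with the permanent's low bits (B,
  `ZMod.val_natCast`, `Nat.testBit_mod_two_pow`), absorb `((L+2)(k+2))^d ≤ n^((c+20)d)`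
  (`poly_absorb`) and contradict (A) at exponent `(c+20)·d`. The final `example : ConstantFreeJetGrowth`
  wires the sorried stubs into it (the crux closed modulo the three stubs).

Disproof used: none exists (`ledger crux ls stmt-ValiantsHypothesis-16738` = no workfiles, no
`Disproof.lean`, no `_false_without_` theorem at registration time, 2026-08-17). The refuter's
standing disprover target (R3-review: "k-uniform `n^(c₀)` constant-free circuits for fixed jets ⇔
FPT-size circuits for per mod 2^k") is exactly `¬A`; the line is honest about it: A is load-bearing
and is where the crux's risk lives. Negatives index (stmt-0340, 3735, 3738, 5668) is disjoint.
-/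

set_option linter.dupNamespace false

namespace Summit.ValiantsHypothesis.ValiantsHypothesis.Cruxes.ConstantFreeJetGrowth.Birth

open scoped BigOperators Classical
open Summit.ValiantsHypothesis.ValiantsHypothesis.Theses.AnyonJets
open Literature.Computability.AlgebraicComplexity
open Literature.Computability.Complexity (CktSize B2)

/-! ## §0 The objects (verbatim the route's inline terms) -/

/-- The `k`-th ANYONIC JET `J_(n,k) = Σ_σ sgn σ · C(inv σ, k) · Π_i X_(σ i, i) ∈ ℤ[x]`
(verbatim the route's `let J := …`; `inv σ = #{(i,j) : i < j, σ j < σ i}`). [route AnyonJets] -/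
noncomputable def jet (n k : ℕ) : MvPolynomial (Fin n × Fin n) ℤ :=
  ∑ σ : Equiv.Perm (Fin n), MvPolynomial.C (((Equiv.Perm.sign σ : ℤˣ) : ℤ) *
    (((Finset.univ.filter (fun p : Fin n × Fin n => p.1 < p.2 ∧ σ p.2 < σ p.1)).card.choose k : ℕ) : ℤ)) *
    ∏ i : Fin n, MvPolynomial.X (σ i, i)

/-- The truncated resummation (2-adic shadow) `F_(n,k) = Σ_(j<k) (−2)^j J_(n,j)`; by the route's
Resummation `per_n = Σ_(j ≤ C(n,2)) (−2)^j J_(n,j)`, so `F_(n,k) ≡ per_n (mod 2^k)`. [route AnyonJets] -/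
noncomputable def shadow (n k : ℕ) : MvPolynomial (Fin n × Fin n) ℤ :=
  ∑ j ∈ Finset.range k, ((-2 : ℤ) ^ j) • jet n j

/-- The 0/1 point of a Boolean matrix, read in `ZMod (2^k)`. [folklore] -/
def zeroOne (k : ℕ) {n : ℕ} (y : Fin n × Fin n → Bool) : Fin n × Fin n → ZMod (2 ^ k) :=
  fun v => if y v then 1 else 0

/-- The crux, unfolded to the named jet (definitional). -/
theorem constantFreeJetGrowth_iff :
    ConstantFreeJetGrowth ↔ ∀ c : ℕ, ∃ k : ℕ, 1 ≤ k ∧ ∀ n₀ : ℕ, ∃ n : ℕ, n₀ ≤ n ∧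
      n ^ c ≤ constantFreeComplexity (jet n k) := Iff.rfl

/-! ## §1 The three stub statements -/

/-- **B — 2-ADIC SHADOW AT 0/1 POINTS** (stub statement, named; provable now): at every 0/1 point
the truncated resummation is the permutation count modulo `2^k`.
[Valiant1979Permanent §4; route items Resummation / TwoAdicShadow] -/
def TwoAdicShadowCongruence : Prop :=
  ∀ (n k : ℕ) (y : Fin n × Fin n → Bool),
    MvPolynomial.aeval (zeroOne k y) (shadow n k) =
      ((Finset.univ.filter fun σ : Equiv.Perm (Fin n) => ∀ j, y (σ j, j) = true).card : ZMod (2 ^ k))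

/-- **C — BOOLEAN SIMULATION MOD `2^k` AT 0/1 INPUTS** (stub statement, named; provable now from
`cktSize_testBits_aeval_eval`): the `k` bits of `f(y) mod 2^k` cost `((L_ℤ(f) + 2)(k + 2))^d`
Boolean gates, `d` absolute. [Burgisser2000TCS §5 (A3)] -/
def BooleanSimulation : Prop :=
  ∃ d : ℕ, ∀ (n k : ℕ) (f : MvPolynomial (Fin n × Fin n) ℤ),
    CktSize B2 (fun (y : Fin n × Fin n → Bool) (i : Fin k) =>
        Nat.testBit (MvPolynomial.aeval (zeroOne k y) f).val i)
      (((complexity f + 2) * (k + 2)) ^ d)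

/-! ## §2 The registered stubs -/

/-- Stub A (registered obligation; signature = the route's `PerModPowBooleanHard` verbatim): the
Boolean far side. [conjecture-grade: CurticapeanXia2015, Valiant1979Permanent §4,
BjorklundHusfeldtLyckberg2017] -/
theorem stub_perModPowBooleanHard :
    ∀ c : ℕ, ∃ k : ℕ, 1 ≤ k ∧ ∀ n₀ : ℕ, ∃ n : ℕ, n₀ ≤ n ∧
      ¬ Literature.Computability.Complexity.CktSize Literature.Computability.Complexity.B2
        (fun (y : Fin n × Fin n → Bool) (i : Fin k) => Nat.testBit
          ((Finset.univ.filter fun σ : Equiv.Perm (Fin n) => ∀ j, y (σ j, j) = true).card) i)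
        (n ^ c) := by
  sorry

/-- Stub B (registered obligation; signature = `TwoAdicShadowCongruence` verbatim).
[Valiant1979Permanent §4] -/
theorem stub_twoAdicShadowCongruence :
    ∀ (n k : ℕ) (y : Fin n × Fin n → Bool),
      MvPolynomial.aeval (zeroOne k y) (shadow n k) =
        ((Finset.univ.filter fun σ : Equiv.Perm (Fin n) => ∀ j, y (σ j, j) = true).card :
          ZMod (2 ^ k)) := by
  sorry

/-- Stub C (registered obligation; signature = `BooleanSimulation` verbatim).
[Burgisser2000TCS §5 (A3)] -/
theorem stub_booleanSimulation :
    ∃ d : ℕ, ∀ (n k : ℕ) (f : MvPolynomial (Fin n × Fin n) ℤ),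
      CktSize B2 (fun (y : Fin n × Fin n → Bool) (i : Fin k) =>
          Nat.testBit (MvPolynomial.aeval (zeroOne k y) f).val i)
        (((complexity f + 2) * (k + 2)) ^ d) := by
  sorry

/-! ## Name-keyed aliases of the stub statements (hypotheses of the composition)

`Registered.stub_X` is the statement of `stub_X` under the registered stub's short name, so that the
native skeleton audit (hypotheses admissible iff registered obligations / declared stubs BY NAME)
accepts `ConstantFreeJetGrowth_of : Registered.stub_… → … → ConstantFreeJetGrowth`
(device of `Cruxes/RestorationQP/Lines/birth.lean`). -/
namespace Registered

/-- Alias of the route decl `PerModPowBooleanHard` (= the signature of `stub_perModPowBooleanHard`). -/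
abbrev stub_perModPowBooleanHard : Prop := PerModPowBooleanHard
/-- Alias of `TwoAdicShadowCongruence` (= the signature of `stub_twoAdicShadowCongruence`). -/
abbrev stub_twoAdicShadowCongruence : Prop := TwoAdicShadowCongruence
/-- Alias of `BooleanSimulation` (= the signature of `stub_booleanSimulation`). -/
abbrev stub_booleanSimulation : Prop := BooleanSimulation

end Registered

/-! ## §3 Glue lemmas (sorry-free) -/

/-- `J_(n,0) = det_n` (`C(inv σ, 0) = 1`). [folklore] -/
theorem jet_zero (n : ℕ) : jet n 0 = detPoly (Fin n) ℤ := by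
  rw [detPoly_eq_sum, jet]
  refine Finset.sum_congr rfl fun σ _ => ?_
  simp only [Nat.choose_zero_right, Nat.cast_one, mul_one, Int.cast_id]

/-- Integer complexity of a fixed jet under the negated crux: `L_ℤ(J_(n,j)) ≤ 8(n+1)^7 + n^c`
(`j = 0`: Berkowitz; `j ≥ 1`: `L_ℤ ≤ τ < n^c`). [Berkowitz1984; Burgisser2000 §1.4] -/
theorem complexity_jet_le {n j c : ℕ}
    (hτ : 1 ≤ j → constantFreeComplexity (jet n j) < n ^ c) :
    complexity (jet n j) ≤ 8 * (n + 1) ^ 7 + n ^ c := by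
  rcases Nat.eq_zero_or_pos j with rfl | hj
  · rw [jet_zero]
    exact (complexity_detPoly_le ℤ n).trans (Nat.le_add_right _ _)
  · have h1 : complexity (jet n j) ≤ constantFreeComplexity (jet n j) :=
      complexity_le_constantFreeComplexity_holds
        (ArithCircuit.exists_computes_hasSignConstants_holds (jet n j))
    exact h1.trans ((hτ hj).le.trans (Nat.le_add_left _ _))

/-- Integer complexity of the truncated resummation: one scalar gate and one addition per jet.
[Burgisser2000 §2.1] -/
theorem complexity_shadow_le {n k c : ℕ}
    (hτ : ∀ j, j < k → 1 ≤ j → constantFreeComplexity (jet n j) < n ^ c) :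
    complexity (shadow n k) ≤ k * (8 * (n + 1) ^ 7 + n ^ c + 1) + k := by
  unfold shadow
  calc complexity (∑ j ∈ Finset.range k, ((-2 : ℤ) ^ j) • jet n j)
      ≤ ∑ j ∈ Finset.range k, complexity (((-2 : ℤ) ^ j) • jet n j) + (Finset.range k).card :=
        complexity_finset_sum_le _ _
    _ ≤ ∑ j ∈ Finset.range k, (8 * (n + 1) ^ 7 + n ^ c + 1) + (Finset.range k).card := by
        gcongr with j hj
        exact (complexity_smul_le_holds _ _).trans
          (Nat.add_le_add_right (complexity_jet_le (hτ j (Finset.mem_range.1 hj))) 1)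
    _ = k * (8 * (n + 1) ^ 7 + n ^ c + 1) + k := by
        rw [Finset.sum_const, Finset.card_range, smul_eq_mul]

/-- Size bookkeeping of the composition: with `k + 2 ≤ n` and the bound of `complexity_shadow_le`,
`(L + 2)(k + 2) ≤ n^(c+20)`. [folklore] -/
theorem poly_absorb (c k n L : ℕ) (hk : k + 2 ≤ n)
    (hL : L ≤ k * (8 * (n + 1) ^ 7 + n ^ c + 1) + k) :
    (L + 2) * (k + 2) ≤ n ^ (c + 20) := by
  have hn2 : 2 ≤ n := by omega
  have hn1 : 1 ≤ n := by omega
  have hkn : k ≤ n := by omega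
  have h1 : (n + 1) ^ 7 ≤ 2 ^ 7 * n ^ 7 := by
    rw [← mul_pow]; exact Nat.pow_le_pow_left (by omega) 7
  have h2 : n ^ 7 ≤ n ^ (c + 7) := Nat.pow_le_pow_right hn1 (by omega)
  have h3 : n ^ c ≤ n ^ (c + 7) := Nat.pow_le_pow_right hn1 (by omega)
  have h4 : 1 ≤ n ^ (c + 7) := Nat.one_le_pow _ _ hn1
  have h5 : 8 * (n + 1) ^ 7 + n ^ c + 1 ≤ 1026 * n ^ (c + 7) := by omega
  have h6 : k * (8 * (n + 1) ^ 7 + n ^ c + 1) ≤ n * (1026 * n ^ (c + 7)) :=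
    Nat.mul_le_mul hkn h5
  have h7 : n * (1026 * n ^ (c + 7)) = 1026 * n ^ (c + 8) := by ring
  have h8 : n ≤ n ^ (c + 8) := by
    calc n = n ^ 1 := (pow_one n).symm
      _ ≤ n ^ (c + 8) := Nat.pow_le_pow_right hn1 (by omega)
  have h9 : L + 2 ≤ 1027 * n ^ (c + 8) := by omega
  have h10 : (L + 2) * (k + 2) ≤ 1027 * n ^ (c + 8) * n := Nat.mul_le_mul h9 hk
  have h11 : (2 : ℕ) ^ 11 ≤ n ^ 11 := Nat.pow_le_pow_left hn2 11
  have h12 : 1027 * n ^ (c + 8) * n ≤ n ^ 11 * (n ^ (c + 8) * n) := by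
    rw [mul_assoc]
    exact Nat.mul_le_mul_right _ (le_trans (by norm_num) h11)
  calc (L + 2) * (k + 2) ≤ 1027 * n ^ (c + 8) * n := h10
    _ ≤ n ^ 11 * (n ^ (c + 8) * n) := h12
    _ = n ^ (c + 20) := by ring

/-! ## §4 The composition (kernel-checked) -/

/-- **Composition** (the glue of the line, kernel-checked, no `sorry`): the Boolean far side (A),
the 2-adic shadow at 0/1 points (B) and Boolean simulation mod `2^k` (C) give constant-free jet
growth. Contrapositive: if one exponent `c` bounded `τ(J_(n,k))` eventually for every fixed
`k ≥ 1`, then for the `k` given by (A) at exponent `(c+20)·d` and all large `n` the truncated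
resummation `F_(n,k)` has `L_ℤ ≤ k(8(n+1)^7 + n^c + 1) + k` (`complexity_shadow_le`), its value
mod `2^k` at 0/1 points has `B₂`-circuits of size `((L+2)(k+2))^d ≤ n^((c+20)d)` (C, `poly_absorb`),
and those bits ARE the permanent's `k` low bits (B) — contradicting (A) at some `n` past every
threshold. [CurticapeanXia2015; Burgisser2000TCS §5; Valiant1979Permanent §4] -/
theorem ConstantFreeJetGrowth_of :
    Registered.stub_perModPowBooleanHard → Registered.stub_twoAdicShadowCongruence →
      Registered.stub_booleanSimulation → ConstantFreeJetGrowth := by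
  intro hA hB hC
  rw [constantFreeJetGrowth_iff]
  by_contra hneg
  push Not at hneg
  -- one exponent `c` bounds every fixed jet (`k ≥ 1`) eventually
  obtain ⟨c, hc⟩ := hneg
  have hc' : ∀ k : ℕ, ∃ n₀ : ℕ, ∀ n : ℕ, n₀ ≤ n → 1 ≤ k →
      constantFreeComplexity (jet n k) < n ^ c := by
    intro k
    rcases Nat.eq_zero_or_pos k with rfl | hk
    · exact ⟨0, fun n _ h => absurd h (by omega)⟩
    · obtain ⟨n₀, h⟩ := hc k hk
      exact ⟨n₀, fun n hn _ => h n hn⟩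
  choose N hN using hc'
  -- the simulation exponent and the Boolean far side at exponent `(c + 20) * d`
  obtain ⟨d, hd⟩ := hC
  obtain ⟨k, hk1, hk⟩ := hA ((c + 20) * d)
  obtain ⟨n, hn, hhard⟩ := hk (∑ j ∈ Finset.range k, N j + k + 2)
  apply hhard
  -- every threshold `N j`, `j < k`, is below `n`, and `k + 2 ≤ n`
  have hNj : ∀ j, j < k → N j ≤ n := fun j hj =>
    le_trans (Finset.single_le_sum (fun i _ => Nat.zero_le (N i)) (Finset.mem_range.2 hj))
      (by omega)
  have hkn : k + 2 ≤ n := by omega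
  -- integer complexity of the truncated resummation
  have hshadow : complexity (shadow n k) ≤ k * (8 * (n + 1) ^ 7 + n ^ c + 1) + k :=
    complexity_shadow_le fun j hj hj1 => hN j n (hNj j hj) hj1
  -- size absorption
  have hsize : ((complexity (shadow n k) + 2) * (k + 2)) ^ d ≤ n ^ ((c + 20) * d) := by
    rw [pow_mul]
    exact Nat.pow_le_pow_left (poly_absorb c k n _ hkn hshadow) d
  -- Boolean simulation of `F_(n,k) mod 2^k` at 0/1 points, outputs identified by the shadow
  refine CktSize.of_le (CktSize.congr (hd n k (shadow n k)) fun y i => ?_) hsize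
  show Nat.testBit (MvPolynomial.aeval (zeroOne k y) (shadow n k)).val i = _
  rw [hB n k y, ZMod.val_natCast, Nat.testBit_mod_two_pow]
  simp [i.2]

/-- Wiring check: the registered stubs feed `ConstantFreeJetGrowth_of` exactly as stated, so the
skeleton is `ConstantFreeJetGrowth` closed modulo the three stubs (sorries enter only through them). -/
example : ConstantFreeJetGrowth :=
  ConstantFreeJetGrowth_of stub_perModPowBooleanHard stub_twoAdicShadowCongruence
    stub_booleanSimulation

end Summit.ValiantsHypothesis.ValiantsHypothesis.Cruxes.ConstantFreeJetGrowth.Birth
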